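import Summits.QuantumFields.YangMills.Theorems.SmallFieldWideningLargeFieldMassRefinementTailOfSeparatedUnitRow
import Summits.QuantumFields.YangMills.Theorems.SmallFieldWideningLargeFieldMassRefinementTailUnitTop

/-!
# Route `SmallFieldWidening`, crux r3 `LargeFieldMassRefinementTail` (stmt-QuantumFields-22884): the separated-family unit-top
# large-field row, file 2 — THE PER-RUN ESTIMATE and the UNIFORM (all-profile) door to `UnitTop`, hence to r3 / `FirstExitWindowTailL`
# (stmt-QuantumFields-26243) / `HistoryTailL` (stmt-QuantumFields-19936) BY NAME
# (support file, width seat `ym-line-sfw-p2-w3` gen 25; conditional certificates — every crux and rung R3 stay OPEN; the Yang–Mills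
# mass gap is NOT proved by any of this)

File 1 (`…LargeFieldMassRefinementTailOfSeparatedUnitRow`, p639530) proves r3 from a PER-FAMILY separated-family row (one profile per `L`,
constants per `(F, γ)`, deep refinements) with the computation inlined.  THIS FILE isolates the computation as a PER-RUN lemma and
draws the all-profile corollary:

* §1 ★ **`gibbsK_real_unitPlaq_le_of_rowAt`** — ONE run `K` of ONE family `F` at ONE coupling `0 < γ ≤ 1`: if every finite set `S` of
  unit plaquettes pairwise `(1 + R·x^r)`-separated (`x = 1 + log(√γ)⁻¹`) satisfies the row
  `Gibbs_K{∀ q ∈ S, θ(0) ≤ |Ū^K(∂q) − 1|} ≤ (A·γ^{−N})^{sitesPerDir(K)³}·exp(−c·p(√γ)²·|S|)`, and the budget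
  `8L³(5+R)³(log A + 2N)·x'^{3r+1} − (c b₀²/2)·x'^{2p₀} ≤ C₂` holds on `[1, ∞)`, then EVERY unit plaquette `p` has
  `Gibbs_K{θ(0) ≤ |Ū^K(∂p) − 1|} ≤ e^{C₂}·exp(−(c/2)·p(√γ)²)` — the landed reflection-positivity chessboard
  `HistoryTailChessboardT3.chessboardRP_T3` at `j = K` with `ρ = 1 + R x^r`, the `|S|`-th root, and the budget.
* §2 ★ **`unitTop_of_separatedUnitRowUniform`** — the UNIFORM row (for every block size `L` and EVERY profile `0 < b₀`, `2 < p₀`: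
  separation exponents `r, R ≥ 0` with `3r + 1 < 2p₀` and constants `γ₁ ∈ (0,1]`, `A ≥ 1`, `c > 0`, `N` fixed BEFORE the family, the row
  holding for every family of block size `L`, every `γ ≤ γ₁`, every run `K ≥ 2` and every separated `S`) gives the all-profile unit-top
  tail `UnitTop` (the hypothesis of the landed `LargeFieldMassRefinementTailUnitTop.*_of_unitTop` doors), hence
  `largeFieldMassRefinementTail_of_separatedUnitRowUniform` (r3), `firstExitWindowTailL_of_separatedUnitRowUniform` (26243),
  `historyTailL_of_separatedUnitRowUniform` (19936) BY NAME.  Less supplier-friendly than file 1 (all profiles: `3r + 1 < 2p₀` for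
  every `p₀ > 2` forces `r < 1`; volume-uniform constants), recorded for the three-crux reach of the global-row door.

HONEST SCOPE.  The rows are HYPOTHESES (the currency of two-sided UV-stable free-energy bounds with terminal large-field factors,
[Balaban1985UV3] Thm 1 (5), (70)–(71) — not printed as probability statements, not claimed); reflection positivity is the tree's
(fleet `ym-ust-18916`, Osterwalder–Seiler + Fröhlich–Israel–Lieb–Simon); nothing of Bałaban's estimates is proved; no summit
statement is touched (rung R3 `YM3TorusSU2` is a RECORD rung; the Yang–Mills mass gap is NOT proved by any of this).

References: J. Fröhlich, R. Israel, E. Lieb, B. Simon, CMP **62** (1978) 1–34 [FrohlichIsraelLiebSimon1978] Thm. 4.1;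
T. Bałaban, CMP **102** (1985) 255–275 [Balaban1985UV3] ((5) p.256, (7) p.257, (70)–(71) p.273).
-/

noncomputable section

open MeasureTheory Finset
open Literature.MathematicalPhysics.QuantumFieldTheory.Balaban1983to89
open Literature.MathematicalPhysics.QuantumFieldTheory.Balaban1983to89.T3ContinuumYM3Torus
open Literature.MathematicalPhysics.QuantumFieldTheory.Balaban1983to89.T3UnitScaleTilt
open Literature.MathematicalPhysics.QuantumFieldTheory.Balaban1983to89.T3UnitLawDensityEML (ℰp measurableE_ℰp)
open Summit.QuantumFields.YangMills.Theorems.HistoryTailChessboardT3 (chessboardRP_T3)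
open Summit.QuantumFields.YangMills.Theorems.LargeFieldMassRefinementTailOfSeparatedUnitRow (exists_forall_rpow_sub_rpow_le)
open Summit.QuantumFields.YangMills.Theorems.LargeFieldMassRefinementTailUnitTop
  (largeFieldMassRefinementTail_of_unitTop firstExitWindowTailL_of_unitTop historyTailL_of_unitTop)

namespace Summit.QuantumFields.YangMills.Theorems.UnitTopOfSeparatedUnitRow

/-! ## §1 The per-run estimate: row for separated families of ONE run ⇒ the unit-top tail of that run -/

/-- ★ **THE PER-RUN ESTIMATE.**  One family `F`, one coupling `0 < γ ≤ 1`, one run `K`, a profile `(b₀, p₀)`, separation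
exponents `r, R ≥ 0`, row constants `A ≥ 1`, `c > 0`, `N`, and a budget constant `C₂` with
`8L³(5+R)³(log A + 2N)·x'^{3r+1} − (c b₀²/2)·x'^{2p₀} ≤ C₂` for all `x' ≥ 1`: if every finite set `S` of unit plaquettes of run `K`,
pairwise `(1 + R·x^r)`-separated in the `ℓ¹` torus distance of base points (`x = 1 + log(√γ)⁻¹`), satisfies
`Gibbs_K{∀ q ∈ S, θBal(0) ≤ |Ū^K(∂q) − 1|} ≤ (A·γ^{−N})^{sitesPerDir(K)³}·exp(−c·p(√γ)²·|S|)`, then for EVERY unit plaquette `p`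
`Gibbs_K{θBal(0) ≤ |Ū^K(∂p) − 1|} ≤ e^{C₂}·exp(−(c/2)·p(√γ)²)`.  Proof: `chessboardRP_T3` (tree; RP + FILS chessboard, cells of side
`L^s ≥ ρ + 4`) at height `j = K` with `ρ = 1 + R x^r`, the `|S|`-th root of the row, `sitesPerDir³/|S| ≤ 8(L(ρ+4))³ ≤ 8L³(5+R)³x^{3r}`,
`log(Aγ^{−N}) ≤ (log A + 2N)·x`, `p(√γ)² = b₀²x^{2p₀}`, and the budget. [cite: FrohlichIsraelLiebSimon1978, Thm. 4.1; Balaban1985UV3, (70)-(71) p.273] -/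
theorem gibbsK_real_unitPlaq_le_of_rowAt (F : T3Family) {γ : ℝ} (hγ : 0 < γ) (hγ1 : γ ≤ 1)
    {b₀ p₀ r R A c C₂ : ℝ} {N : ℕ} (hr : 0 ≤ r) (hR : 0 ≤ R) (hA : 1 ≤ A) (hc : 0 < c)
    (hbudget : ∀ x : ℝ, 1 ≤ x →
      8 * (F.L : ℝ) ^ 3 * (5 + R) ^ 3 * (Real.log A + 2 * N) * x ^ (3 * r + 1) - c * b₀ ^ 2 / 2 * x ^ (2 * p₀) ≤ C₂)
    (K : ℕ)
    (hrowK : ∀ S : Finset (Plaq (F.P K) K),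
      (∀ q ∈ S, ∀ q' ∈ S, q ≠ q' → 1 + R * (1 + Real.log (Real.sqrt γ)⁻¹) ^ r ≤ (Site.tdist q.src q'.src : ℝ)) →
      (gibbsK F ℰp γ K).real
          {V | ∀ q ∈ S, θBal F.L γ b₀ p₀ 0 ≤ GaugeGroup.dist1 (GaugeField.plaqHol
              (Averaging.iter (fun i => BlockAveraging.blockAvg (P := F.P K) (j := i) ℰp) K V) q)} ≤
        (A * (γ⁻¹) ^ N) ^ ((F.P K).sitesPerDir K ^ 3) * Real.exp (-(c * B10.pFun b₀ p₀ (Real.sqrt γ) ^ 2 * S.card)))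
    (p : Plaq (F.P K) K) :
    (gibbsK F ℰp γ K).real
        {U | θBal F.L γ b₀ p₀ 0 ≤ GaugeGroup.dist1 (GaugeField.plaqHol
            (Averaging.iter (fun i => BlockAveraging.blockAvg (P := F.P K) (j := i) ℰp) K U) p)} ≤
      Real.exp C₂ * Real.exp (-(c / 2 * B10.pFun b₀ p₀ (Real.sqrt γ) ^ 2)) := by
  have hLodd : Odd F.L := F.hL.1
  have hL1 : 1 < F.L := F.hL.2
  have hLR : (1 : ℝ) < (F.L : ℝ) := by exact_mod_cast hL1
  have hL0 : (0 : ℝ) < (F.L : ℝ) := by linarith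
  have hlogA : 0 ≤ Real.log A := Real.log_nonneg hA
  have hsq : 0 < Real.sqrt γ := Real.sqrt_pos.mpr hγ
  have hsq1 : Real.sqrt γ ≤ 1 := (Real.sqrt_le_sqrt hγ1).trans_eq Real.sqrt_one
  -- the logarithmic unit `x = 1 + log (√γ)⁻¹` and the separation `ρ = 1 + R x^r`
  obtain ⟨x, hx_def⟩ : ∃ x : ℝ, x = 1 + Real.log (Real.sqrt γ)⁻¹ := ⟨_, rfl⟩
  have hx : 1 ≤ x := by
    rw [hx_def]
    have : 0 ≤ Real.log (Real.sqrt γ)⁻¹ := Real.log_nonneg ((one_le_inv₀ hsq).mpr hsq1)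
    linarith
  have hx0 : 0 < x := lt_of_lt_of_le one_pos hx
  have hxr : 1 ≤ x ^ r := Real.one_le_rpow hx hr
  obtain ⟨ρ, hρ_def⟩ : ∃ ρ : ℝ, ρ = 1 + R * x ^ r := ⟨_, rfl⟩
  have hρ : 1 ≤ ρ := by rw [hρ_def]; nlinarith
  -- the chessboard at the unit top
  obtain ⟨S, hpS, hsep, hdense, hcb⟩ :=
    chessboardRP_T3 F.L hLodd hL1 F γ rfl hγ hγ1 (θBal F.L γ b₀ p₀ 0) K K le_rfl ρ hρ p
  have hS : 0 < S.card := Finset.card_pos.mpr ⟨p, hpS⟩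
  have hs : (0 : ℝ) < (S.card : ℝ) := by exact_mod_cast hS
  -- the row at `S`
  have hrowS := hrowK S (fun q hq q' hq' hne => by
    rw [← hx_def, ← hρ_def]; exact hsep q hq q' hq' hne)
  clear hrowK hsep
  haveI := isProbabilityMeasure_gibbsK F ℰp hγ.le K
  -- opaque abbreviations
  obtain ⟨B, hB_def⟩ : ∃ B : ℝ, B = A * (γ⁻¹) ^ N := ⟨_, rfl⟩
  obtain ⟨V, hV_def⟩ : ∃ V : ℕ, V = (F.P K).sitesPerDir K ^ 3 := ⟨_, rfl⟩
  obtain ⟨P2, hP2_def⟩ : ∃ P2 : ℝ, P2 = B10.pFun b₀ p₀ (Real.sqrt γ) ^ 2 := ⟨_, rfl⟩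
  obtain ⟨D, hD_def⟩ : ∃ D : ℝ, D = 8 * ((F.L : ℝ) * (ρ + 4)) ^ 3 := ⟨_, rfl⟩
  rw [← hB_def, ← hV_def, ← hP2_def] at hrowS
  rw [← hP2_def]
  have hγinv : 1 ≤ γ⁻¹ := (one_le_inv₀ hγ).mpr hγ1
  have hB1 : 1 ≤ B := by
    rw [hB_def]
    exact one_le_mul_of_one_le_of_one_le hA (one_le_pow₀ hγinv)
  have hB0 : 0 < B := lt_of_lt_of_le one_pos hB1
  have hD0 : 0 ≤ D := by rw [hD_def]; positivity
  -- (1)+(2) chessboard and the row under the root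
  have step2 : ((gibbsK F ℰp γ K).real
        {U | ∀ q ∈ S, θBal F.L γ b₀ p₀ 0 ≤ GaugeGroup.dist1 (GaugeField.plaqHol
          (Averaging.iter (fun i => BlockAveraging.blockAvg (P := F.P K) (j := i) ℰp) K U) q)}) ^
        ((1 : ℝ) / (S.card : ℝ)) ≤
      ((B ^ V) * Real.exp (-(c * P2 * S.card))) ^ ((1 : ℝ) / (S.card : ℝ)) :=
    Real.rpow_le_rpow measureReal_nonneg hrowS (by positivity)
  -- (3) algebra of the root
  have step3 : ((B ^ V) * Real.exp (-(c * P2 * S.card))) ^ ((1 : ℝ) / (S.card : ℝ)) =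
      B ^ ((V : ℝ) / (S.card : ℝ)) * Real.exp (-(c * P2)) := by
    rw [Real.mul_rpow (pow_nonneg hB0.le _) (Real.exp_nonneg _), ← Real.rpow_natCast, ← Real.rpow_mul hB0.le,
      ← Real.exp_mul]
    have e : -(c * P2 * (S.card : ℝ)) * ((1 : ℝ) / (S.card : ℝ)) = -(c * P2) := by
      field_simp
    rw [mul_one_div, e]
  -- (4) the density: `V / |S| ≤ D`
  have hdense' : ((V : ℕ) : ℝ) ≤ (S.card : ℝ) * D := by
    rw [hV_def, Nat.cast_pow, hD_def]
    exact hdense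
  have hVD : (V : ℝ) / (S.card : ℝ) ≤ D := by
    rw [div_le_iff₀ hs, mul_comm]
    exact hdense'
  have step4 : B ^ ((V : ℝ) / (S.card : ℝ)) ≤ B ^ D := Real.rpow_le_rpow_of_exponent_le hB1 hVD
  -- (5) the budget: `B^D · e^{−cP²} ≤ e^{C₂} · e^{−(c/2)P²}`
  have hlogγ : Real.log γ⁻¹ = 2 * (x - 1) := by
    rw [hx_def, Real.log_inv, Real.log_inv, Real.log_sqrt hγ.le]; ring
  have hlogB : Real.log B ≤ (Real.log A + 2 * N) * x := by
    rw [hB_def, Real.log_mul (by positivity) (by positivity), Real.log_pow, hlogγ]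
    have hN0 : (0 : ℝ) ≤ N := Nat.cast_nonneg N
    have h1 : Real.log A ≤ Real.log A * x := le_mul_of_one_le_right hlogA hx
    have h2 : (N : ℝ) * (2 * (x - 1)) ≤ 2 * N * x := by nlinarith
    linarith
  have hlogB0 : 0 ≤ Real.log B := Real.log_nonneg hB1
  have hρ4 : ρ + 4 ≤ (5 + R) * x ^ r := by
    have e : (5 + R) * x ^ r = 5 * x ^ r + R * x ^ r := by ring
    rw [hρ_def, e]; linarith [hxr]
  have hx3 : (x ^ r) ^ (3 : ℕ) = x ^ (3 * r) := by
    rw [← Real.rpow_natCast, ← Real.rpow_mul hx0.le]; congr 1; push_cast; ring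
  have hD : D ≤ 8 * (F.L : ℝ) ^ 3 * (5 + R) ^ 3 * x ^ (3 * r) := by
    rw [hD_def]
    have h1 : ((F.L : ℝ) * (ρ + 4)) ^ 3 ≤ ((F.L : ℝ) * ((5 + R) * x ^ r)) ^ 3 :=
      pow_le_pow_left₀ (by positivity) (mul_le_mul_of_nonneg_left hρ4 hL0.le) 3
    have h2 : ((F.L : ℝ) * ((5 + R) * x ^ r)) ^ 3 = (F.L : ℝ) ^ 3 * (5 + R) ^ 3 * x ^ (3 * r) := by
      rw [mul_pow, mul_pow, hx3]; ring
    linarith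
  have hDlogB : D * Real.log B ≤ 8 * (F.L : ℝ) ^ 3 * (5 + R) ^ 3 * (Real.log A + 2 * N) * x ^ (3 * r + 1) := by
    calc D * Real.log B ≤ (8 * (F.L : ℝ) ^ 3 * (5 + R) ^ 3 * x ^ (3 * r)) * ((Real.log A + 2 * N) * x) :=
          mul_le_mul hD hlogB hlogB0 (by positivity)
      _ = 8 * (F.L : ℝ) ^ 3 * (5 + R) ^ 3 * (Real.log A + 2 * N) * x ^ (3 * r + 1) := by
          rw [Real.rpow_add hx0, Real.rpow_one]; ring
  have hx2 : (x ^ p₀) ^ (2 : ℕ) = x ^ (2 * p₀) := by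
    rw [← Real.rpow_natCast, ← Real.rpow_mul hx0.le]; congr 1; push_cast; ring
  have hP2 : P2 = b₀ ^ 2 * x ^ (2 * p₀) := by
    rw [hP2_def, B10LargeField.pFun_eq]
    unfold B10LargeField.xlog
    rw [← hx_def, mul_pow, hx2]
  have hbud := hbudget x hx
  have step5 : B ^ D * Real.exp (-(c * P2)) ≤ Real.exp C₂ * Real.exp (-(c / 2 * P2)) := by
    rw [Real.rpow_def_of_pos hB0, ← Real.exp_add, ← Real.exp_add]
    refine Real.exp_le_exp.mpr ?_
    rw [hP2, mul_comm (Real.log B) D]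
    have h3 : c * (b₀ ^ 2 * x ^ (2 * p₀)) = 2 * (c * b₀ ^ 2 / 2 * x ^ (2 * p₀)) := by ring
    have h4 : c / 2 * (b₀ ^ 2 * x ^ (2 * p₀)) = c * b₀ ^ 2 / 2 * x ^ (2 * p₀) := by ring
    rw [h3, h4]
    linarith [hDlogB, hbud]
  -- assemble
  have hfin : B ^ ((V : ℝ) / (S.card : ℝ)) * Real.exp (-(c * P2)) ≤ Real.exp C₂ * Real.exp (-(c / 2 * P2)) :=
    le_trans (mul_le_mul_of_nonneg_right step4 (Real.exp_nonneg _)) step5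
  exact hcb.trans (step2.trans (step3.le.trans hfin))

/-! ## §2 The uniform (all-profile) row ⇒ `UnitTop` ⇒ r3 / 26243 / 19936 by name -/

/-- ★ **`UnitTop` ⇐ THE UNIFORM SEPARATED-FAMILY UNIT-TOP ROW.**  The row (hypothesis `hRowU`, NOT claimed): for every `L` and every
profile `0 < b₀`, `2 < p₀` there are `r, R ≥ 0` with `3r + 1 < 2p₀` and `γ₁ ∈ (0,1]`, `A ≥ 1`, `c > 0`, `N` such that for every family
`F` (`F.L = L`), every `0 < γ ≤ γ₁`, every run `K ≥ 2` and every finite set `S` of unit plaquettes pairwise `(1 + R·x^r)`-separated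
(`x = 1 + log(√γ)⁻¹`): `Gibbs_K{∀ q ∈ S, θBal(0) ≤ |Ū^K(∂q) − 1|} ≤ (A·γ^{−N})^{sitesPerDir(K)³}·exp(−c·p(√γ)²·|S|)`.  Conclusion: the
all-profile unit-top tail `UnitTop` (the hypothesis of `LargeFieldMassRefinementTailUnitTop.largeFieldMassRefinementTail_of_unitTop`) with
constants `(γ₁, e^{C₂}, c/2, N = 0)` — §1 per run, the small sub-unit history dropped by monotonicity.  Conditional certificate; nothing about
the mass gap. [cite: FrohlichIsraelLiebSimon1978, Thm. 4.1; Balaban1985UV3, (5) p.256 and (70)-(71) p.273] -/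
theorem unitTop_of_separatedUnitRowUniform
    (hRowU : ∀ (L : ℕ) (b₀ p₀ : ℝ), 0 < b₀ → 2 < p₀ → ∃ (r R γ₁ A c : ℝ) (N : ℕ), 0 ≤ r ∧ 0 ≤ R ∧ 3 * r + 1 < 2 * p₀ ∧
      0 < γ₁ ∧ γ₁ ≤ 1 ∧ 1 ≤ A ∧ 0 < c ∧
      ∀ (F : T3Family) (γ : ℝ), F.L = L → 0 < γ → γ ≤ γ₁ → ∀ K : ℕ, 2 ≤ K → ∀ S : Finset (Plaq (F.P K) K),
        (∀ q ∈ S, ∀ q' ∈ S, q ≠ q' → 1 + R * (1 + Real.log (Real.sqrt γ)⁻¹) ^ r ≤ (Site.tdist q.src q'.src : ℝ)) →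
        (gibbsK F ℰp γ K).real
            {V | ∀ q ∈ S, θBal F.L γ b₀ p₀ 0 ≤ GaugeGroup.dist1 (GaugeField.plaqHol
                (Averaging.iter (fun i => BlockAveraging.blockAvg (P := F.P K) (j := i) ℰp) K V) q)} ≤
          (A * (γ⁻¹) ^ N) ^ ((F.P K).sitesPerDir K ^ 3) * Real.exp (-(c * B10.pFun b₀ p₀ (Real.sqrt γ) ^ 2 * S.card))) :
    ∀ (L : ℕ) (b₀ p₀ : ℝ), 0 < b₀ → 2 < p₀ → ∃ (γ₁ C c : ℝ) (N : ℕ), 0 < γ₁ ∧ γ₁ ≤ 1 ∧ 0 < c ∧ 0 ≤ C ∧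
      ∀ (F : T3Family) (γ : ℝ), F.L = L → 0 < γ → γ ≤ γ₁ → ∀ (K : ℕ), 2 ≤ K → ∀ p : Plaq (F.P K) K,
        (gibbsK F ℰp γ K).real {U | (∀ k, k < K → PlaqSmall (θBal F.L γ b₀ p₀ (K - k))
            (Averaging.iter (fun i => BlockAveraging.blockAvg (P := F.P K) (j := i) ℰp) k U)) ∧
          θBal F.L γ b₀ p₀ 0 ≤ GaugeGroup.dist1 (GaugeField.plaqHol
            (Averaging.iter (fun i => BlockAveraging.blockAvg (P := F.P K) (j := i) ℰp) K U) p)} ≤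
        C * (γ⁻¹) ^ N * Real.exp (-(c * B10.pFun b₀ p₀ (Real.sqrt γ) ^ 2)) := by
  intro L b₀ p₀ hb₀ hp₀
  obtain ⟨r, R, γ₁, A, c, N, hr, hR, hrp, hγ₁, hγ₁1, hA, hc, hrow⟩ := hRowU L b₀ p₀ hb₀ hp₀
  clear hRowU
  -- the budget constant; `L` enters through `F.L = L`, so it is the same for every family of block size `L`
  have hlogA : 0 ≤ Real.log A := Real.log_nonneg hA
  have hC₁0 : 0 ≤ 8 * (L : ℝ) ^ 3 * (5 + R) ^ 3 * (Real.log A + 2 * N) := by positivity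
  have hκ : 0 < c * b₀ ^ 2 / 2 := by positivity
  obtain ⟨C₂, -, hbudget⟩ :=
    exists_forall_rpow_sub_rpow_le (a := 3 * r + 1) (b := 2 * p₀)
      (C₁ := 8 * (L : ℝ) ^ 3 * (5 + R) ^ 3 * (Real.log A + 2 * N)) (by linarith) hrp hC₁0 hκ
  refine ⟨γ₁, Real.exp C₂, c / 2, 0, hγ₁, hγ₁1, half_pos hc, (Real.exp_pos C₂).le, fun F γ hFL hγ hle K hK p => ?_⟩
  have hγ1 : γ ≤ 1 := hle.trans hγ₁1
  haveI := isProbabilityMeasure_gibbsK F ℰp hγ.le K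
  have hrowK := hrow F γ hFL hγ hle K hK
  subst hFL
  have h := gibbsK_real_unitPlaq_le_of_rowAt F hγ hγ1 hr hR hA hc hbudget K hrowK p
  rw [pow_zero, mul_one]
  exact le_trans (measureReal_mono (fun U hU => hU.2) (measure_ne_top _ _)) h

/-- **r3 `LargeFieldMassRefinementTail` (stmt-QuantumFields-22884) ⇐ the uniform separated-family unit-top row** (§2 + the landed
`largeFieldMassRefinementTail_of_unitTop`).  Conditional certificate; nothing about the mass gap. [cite: Balaban1985UV3, (70)-(71) p.273] -/
theorem largeFieldMassRefinementTail_of_separatedUnitRowUniform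
    (hRowU : ∀ (L : ℕ) (b₀ p₀ : ℝ), 0 < b₀ → 2 < p₀ → ∃ (r R γ₁ A c : ℝ) (N : ℕ), 0 ≤ r ∧ 0 ≤ R ∧ 3 * r + 1 < 2 * p₀ ∧
      0 < γ₁ ∧ γ₁ ≤ 1 ∧ 1 ≤ A ∧ 0 < c ∧
      ∀ (F : T3Family) (γ : ℝ), F.L = L → 0 < γ → γ ≤ γ₁ → ∀ K : ℕ, 2 ≤ K → ∀ S : Finset (Plaq (F.P K) K),
        (∀ q ∈ S, ∀ q' ∈ S, q ≠ q' → 1 + R * (1 + Real.log (Real.sqrt γ)⁻¹) ^ r ≤ (Site.tdist q.src q'.src : ℝ)) →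
        (gibbsK F ℰp γ K).real
            {V | ∀ q ∈ S, θBal F.L γ b₀ p₀ 0 ≤ GaugeGroup.dist1 (GaugeField.plaqHol
                (Averaging.iter (fun i => BlockAveraging.blockAvg (P := F.P K) (j := i) ℰp) K V) q)} ≤
          (A * (γ⁻¹) ^ N) ^ ((F.P K).sitesPerDir K ^ 3) * Real.exp (-(c * B10.pFun b₀ p₀ (Real.sqrt γ) ^ 2 * S.card))) :
    Summit.QuantumFields.YangMills.Theses.SmallFieldWidening.LargeFieldMassRefinementTail :=
  largeFieldMassRefinementTail_of_unitTop (unitTop_of_separatedUnitRowUniform hRowU)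

/-- **`FirstExitWindowTailL` (route `FirstExitWindow`, stmt-QuantumFields-26243) ⇐ the uniform separated-family unit-top row** (§2 + the landed
`firstExitWindowTailL_of_unitTop`).  Conditional certificate; nothing about the mass gap. [cite: Balaban1985UV3, (70)-(71) p.273] -/
theorem firstExitWindowTailL_of_separatedUnitRowUniform
    (hRowU : ∀ (L : ℕ) (b₀ p₀ : ℝ), 0 < b₀ → 2 < p₀ → ∃ (r R γ₁ A c : ℝ) (N : ℕ), 0 ≤ r ∧ 0 ≤ R ∧ 3 * r + 1 < 2 * p₀ ∧
      0 < γ₁ ∧ γ₁ ≤ 1 ∧ 1 ≤ A ∧ 0 < c ∧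
      ∀ (F : T3Family) (γ : ℝ), F.L = L → 0 < γ → γ ≤ γ₁ → ∀ K : ℕ, 2 ≤ K → ∀ S : Finset (Plaq (F.P K) K),
        (∀ q ∈ S, ∀ q' ∈ S, q ≠ q' → 1 + R * (1 + Real.log (Real.sqrt γ)⁻¹) ^ r ≤ (Site.tdist q.src q'.src : ℝ)) →
        (gibbsK F ℰp γ K).real
            {V | ∀ q ∈ S, θBal F.L γ b₀ p₀ 0 ≤ GaugeGroup.dist1 (GaugeField.plaqHol
                (Averaging.iter (fun i => BlockAveraging.blockAvg (P := F.P K) (j := i) ℰp) K V) q)} ≤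
          (A * (γ⁻¹) ^ N) ^ ((F.P K).sitesPerDir K ^ 3) * Real.exp (-(c * B10.pFun b₀ p₀ (Real.sqrt γ) ^ 2 * S.card))) :
    Summit.QuantumFields.YangMills.Theses.FirstExitWindow.FirstExitWindowTailL :=
  firstExitWindowTailL_of_unitTop (unitTop_of_separatedUnitRowUniform hRowU)

/-- **K2′ `HistoryTailL` (route `UnitScaleTilt`, stmt-QuantumFields-19936) ⇐ the uniform separated-family unit-top row** (§2 + the landed
`historyTailL_of_unitTop`).  Conditional certificate; nothing about the mass gap. [cite: Balaban1985UV3, (70)-(71) p.273] -/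
theorem historyTailL_of_separatedUnitRowUniform
    (hRowU : ∀ (L : ℕ) (b₀ p₀ : ℝ), 0 < b₀ → 2 < p₀ → ∃ (r R γ₁ A c : ℝ) (N : ℕ), 0 ≤ r ∧ 0 ≤ R ∧ 3 * r + 1 < 2 * p₀ ∧
      0 < γ₁ ∧ γ₁ ≤ 1 ∧ 1 ≤ A ∧ 0 < c ∧
      ∀ (F : T3Family) (γ : ℝ), F.L = L → 0 < γ → γ ≤ γ₁ → ∀ K : ℕ, 2 ≤ K → ∀ S : Finset (Plaq (F.P K) K),
        (∀ q ∈ S, ∀ q' ∈ S, q ≠ q' → 1 + R * (1 + Real.log (Real.sqrt γ)⁻¹) ^ r ≤ (Site.tdist q.src q'.src : ℝ)) →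
        (gibbsK F ℰp γ K).real
            {V | ∀ q ∈ S, θBal F.L γ b₀ p₀ 0 ≤ GaugeGroup.dist1 (GaugeField.plaqHol
                (Averaging.iter (fun i => BlockAveraging.blockAvg (P := F.P K) (j := i) ℰp) K V) q)} ≤
          (A * (γ⁻¹) ^ N) ^ ((F.P K).sitesPerDir K ^ 3) * Real.exp (-(c * B10.pFun b₀ p₀ (Real.sqrt γ) ^ 2 * S.card))) :
    Summit.QuantumFields.YangMills.Theses.UnitScaleTilt.HistoryTailL :=
  historyTailL_of_unitTop (unitTop_of_separatedUnitRowUniform hRowU)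

end Summit.QuantumFields.YangMills.Theorems.UnitTopOfSeparatedUnitRow

end
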